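import Summits.ValiantsHypothesis.ValiantsHypothesis.Theorems.NewtonUnitEquationsTwoProductsRankOneFourLawToric
import Summits.ValiantsHypothesis.ValiantsHypothesis.Theorems.NewtonUnitEquationsTwoProductsFormalLogLinearisationBinomialPencilCount
import HarnessLib

/-!
# Route NewtonUnitEquations — crux `TwoProducts` (stmt-ValiantsHypothesis-5906), line `relation_ladder`, rung R6 (four-term
# rank one): the SEGRE LIFT — the PROVED SPLIT `BinExpPencilCount → RankOneFourLaw` — part 2/6 — balanced exponents, the fibres of the Segre substitution, binomial characters and the tool interface (Parts T3–T4)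

(T3) the four special coordinates (`fourSet`, `rest`, `prod_four_split`, `sum_four_split`), tabulated exponents `ofFun`, BALANCED
exponents (`x a + x b = x c + x d`; toric images are balanced, `balanced_piT`), the reduced exponent `xhat` (coordinates `c, d` set to `0`), the
fibre parametrisation `Lof I x k` / `KR I x` of `piT (segM I) ⁻¹ {x}` (`eq_Lof_of_piT`, `piT_Lof`), degrees (`deg_Lof`, `deg_xhat`,
`deg_eq_deg_xhat_add`) and the multinomial identity `multinomial_Lof`; (T4) binomial characters `binChar ν d a = C(ν,d) a^{ν-d}`
(`binChar_zero_deg`, `binChar_base_zero`, `binChar_eq_zero_of_lt`), the tool interface `BinExpPencilCount` — the VERBATIM copy of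
`R6Tool.BinExpPencilCount` (interface of record `Cruxes/TwoProducts/Lines/relation_ladder_R6_tool.lean` rev 2), now a THEOREM of the tree
(val-lit-p3 g14, `…FormalLogLinearisation.BinExpSum.binExpPencilCount`, wired in part 6/6) — binomial-exponential sums `bsum`, their width
`bwidth`, `toolBound_mono` and the `Fintype`-indexed form `binExpPencilCount_fintype`.

PORT NOTE (val-lit-p11 g1, literature-prover seat, helper mode `--supports stmt-ValiantsHypothesis-5906 --as helper`, no stub credit
claimed): part 2/6 of a VERBATIM Theorems-side port of val-idea-8 g3's sorry-free module
`Cruxes/TwoProducts/Lines/relation_ladder_R6.lean` (tree @1dcc86cce347; file sha256 36828fc46563…; 1 653 lines; `lean check` rc 0, 0 sorries)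
into files of ≤ 400 lines, as tasked by the val-lit desk (RULING #273 (b)). ALL mathematics and ALL proofs below are val-idea-8 g3's (engine
memo `Cruxes/TwoProducts/Lines/relation_ladder_R6_engine.md` rev 3); the port changes only: the file split, the import chain, two deprecated
Mathlib names (`Finsupp.coe_finset_sum` → `Finsupp.coe_finsetSum`, `Finsupp.finset_sum_apply` → `Finsupp.finsetSum_apply`), `omit […] in`
annotations and one-line docstrings on 45 API lemmas required by the tree's zero-warning / docstring lint. Namespace = the author's
(`…Theorems.NewtonUnitEquations.TwoProducts.PermutationType`, as in the R3♯ port `…PermutationType{WeightOrder,Lifted,PushForward,Count,Family}`).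
Nothing here closes the line's residual, the crux `TwoProducts` (5906) or `VP ≠ VNP`; no summit statement is proved.

Cut table: in the module docstring of part 1/6 (`…RankOneFourLawToric`); this file = source l. 296–561.

Honest scope (the author's): shapes `α = β + γ` (R6b), `2β = α + γ` (R6c) and coincidence rank `≥ 2` (R7) are NOT covered and go to the
residual of skeleton v14. Nothing here moves VP ≠ VNP; `TwoProducts` (5906) stays OPEN. [folklore]
-/

noncomputable section

-- Sub = Summit single-conjunct layout: the duplicated namespace component is mandated by the tree.
set_option linter.dupNamespace false
set_option linter.unusedSimpArgs false

namespace Summit.ValiantsHypothesis.ValiantsHypothesis.Theorems.NewtonUnitEquations.TwoProducts.PermutationType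
open scoped BigOperators
open MvPolynomial

variable {σ : Type*} [Fintype σ] [DecidableEq σ]

variable (I : FourIdx σ)

/-! ## Part T3: the four special coordinates, balanced exponents, and the fibres of the Segre substitution -/

/-- The four relation indices as a finset. [folklore] -/
def fourSet : Finset σ := {I.a, I.b, I.c, I.d}

/-- The remaining indices. [folklore] -/
def rest : Finset σ := Finset.univ \ fourSet I

/-- Membership in `rest I`: the indices other than the four special ones `a, b, c, d`. [folklore] -/
theorem mem_rest (j : σ) : j ∈ rest I ↔ j ≠ I.a ∧ j ≠ I.b ∧ j ≠ I.c ∧ j ≠ I.d := by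
  classical
  unfold rest fourSet
  simp only [Finset.mem_sdiff, Finset.mem_univ, true_and, Finset.mem_insert, Finset.mem_singleton, not_or]

/-- Splitting a product over `σ` into the four relation coordinates and the rest. [folklore] -/
theorem prod_four_split {β : Type*} [CommMonoid β] (f : σ → β) :
    ∏ j, f j = (∏ j ∈ rest I, f j) * (f I.a * (f I.b * (f I.c * f I.d))) := by
  classical
  unfold rest fourSet
  rw [← Finset.prod_sdiff (Finset.subset_univ ({I.a, I.b, I.c, I.d} : Finset σ))]
  congr 1
  rw [Finset.prod_insert (by simp [I.hab, I.hac, I.had]), Finset.prod_insert (by simp [I.hbc, I.hbd]),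
    Finset.prod_pair I.hcd]

/-- Splitting a sum over `σ` into the four relation coordinates and the rest. [folklore] -/
theorem sum_four_split {β : Type*} [AddCommMonoid β] (f : σ → β) :
    ∑ j, f j = (∑ j ∈ rest I, f j) + (f I.a + (f I.b + (f I.c + f I.d))) := by
  classical
  unfold rest fourSet
  rw [← Finset.sum_sdiff (Finset.subset_univ ({I.a, I.b, I.c, I.d} : Finset σ))]
  congr 1
  rw [Finset.sum_insert (by simp [I.hab, I.hac, I.had]), Finset.sum_insert (by simp [I.hbc, I.hbd]),
    Finset.sum_pair I.hcd]

/-- A finitely supported function from its table of values (`σ` is finite). [folklore] -/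
def ofFun (f : σ → ℕ) : σ →₀ ℕ := Finsupp.equivFunOnFinite.symm f

omit [DecidableEq σ] in
/-- Evaluation of `ofFun f` at an index returns the tabulated value. [folklore] -/
@[simp] theorem ofFun_apply (f : σ → ℕ) (j : σ) : ofFun f j = f j := by
  simp [ofFun]

/-- Balanced exponents: `Z`-degree = `W`-degree, i.e. `x a + x b = x c + x d`. [folklore] -/
def Balanced (x : σ →₀ ℕ) : Prop := x I.a + x I.b = x I.c + x I.d

/-- Toric images are balanced. [folklore] -/
theorem balanced_piT (L : σ →₀ ℕ) : Balanced I (piT (segM I) L) := by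
  unfold Balanced
  rw [piT_segM_a, piT_segM_b, piT_segM_c, piT_segM_d]; ring

/-- The reduced exponent `x̂`: the coordinates `c, d` (`W₁, W₂`) set to zero. [folklore] -/
def xhat (x : σ →₀ ℕ) : σ →₀ ℕ := ofFun fun j => if j = I.c ∨ j = I.d then 0 else x j

/-- The reduced exponent `x̂` keeps the `a`-coordinate. [folklore] -/
theorem xhat_a (x : σ →₀ ℕ) : xhat I x I.a = x I.a := by
  classical simp [xhat, I.hac, I.had]

/-- The reduced exponent `x̂` keeps the `b`-coordinate. [folklore] -/
theorem xhat_b (x : σ →₀ ℕ) : xhat I x I.b = x I.b := by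
  classical simp [xhat, I.hbc, I.hbd]

/-- The reduced exponent `x̂` has `c`-coordinate `0`. [folklore] -/
theorem xhat_c (x : σ →₀ ℕ) : xhat I x I.c = 0 := by
  classical simp [xhat]

/-- The reduced exponent `x̂` has `d`-coordinate `0`. [folklore] -/
theorem xhat_d (x : σ →₀ ℕ) : xhat I x I.d = 0 := by
  classical simp [xhat]

/-- The reduced exponent `x̂` keeps every coordinate other than `c, d`. [folklore] -/
theorem xhat_other (x : σ →₀ ℕ) (j : σ) (hc : j ≠ I.c) (hd : j ≠ I.d) : xhat I x j = x j := by
  classical simp [xhat, hc, hd]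

/-- The letter multiset in the fibre of the Segre substitution over `x` with `#α = k`:
`#α = k, #β = x b + k - x c, #γ = x a - k, #δ = x c - k`, other letters as in `x`. [folklore] -/
def Lof (x : σ →₀ ℕ) (k : ℕ) : σ →₀ ℕ :=
  ofFun fun j => if j = I.a then k else if j = I.b then x I.b + k - x I.c
    else if j = I.c then x I.a - k else if j = I.d then x I.c - k else x j

/-- The `a`-coordinate (`#α`) of the fibre point `Lof I x k` is `k`. [folklore] -/
theorem Lof_a (x : σ →₀ ℕ) (k : ℕ) : Lof I x k I.a = k := by
  classical simp [Lof]

/-- The `b`-coordinate (`#β`) of the fibre point `Lof I x k` is `x b + k - x c`. [folklore] -/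
theorem Lof_b (x : σ →₀ ℕ) (k : ℕ) : Lof I x k I.b = x I.b + k - x I.c := by
  classical simp [Lof, I.hab.symm]

/-- The `c`-coordinate (`#γ`) of the fibre point `Lof I x k` is `x a - k`. [folklore] -/
theorem Lof_c (x : σ →₀ ℕ) (k : ℕ) : Lof I x k I.c = x I.a - k := by
  classical simp [Lof, I.hac.symm, I.hbc.symm]

/-- The `d`-coordinate (`#δ`) of the fibre point `Lof I x k` is `x c - k`. [folklore] -/
theorem Lof_d (x : σ →₀ ℕ) (k : ℕ) : Lof I x k I.d = x I.c - k := by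
  classical simp [Lof, I.had.symm, I.hbd.symm, I.hcd.symm]

/-- The fibre point `Lof I x k` agrees with `x` away from the four special coordinates. [folklore] -/
theorem Lof_other (x : σ →₀ ℕ) (k : ℕ) (j : σ) (ha : j ≠ I.a) (hb : j ≠ I.b) (hc : j ≠ I.c) (hd : j ≠ I.d) :
    Lof I x k j = x j := by
  classical simp [Lof, ha, hb, hc, hd]

/-- The admissible range of `k = #α` in the fibre over `x`. [folklore] -/
def KR (x : σ →₀ ℕ) : Finset ℕ := Finset.Icc (x I.c - x I.b) (min (x I.a) (x I.c))

omit [Fintype σ] [DecidableEq σ] in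
/-- Membership in the admissible range `KR I x` of `k = #α`. [folklore] -/
theorem mem_KR (x : σ →₀ ℕ) (k : ℕ) : k ∈ KR I x ↔ x I.c ≤ x I.b + k ∧ k ≤ x I.a ∧ k ≤ x I.c := by
  unfold KR; rw [Finset.mem_Icc, le_min_iff]; omega

/-- (F1) Every preimage of `x` is an `Lof x k` with `k` admissible. [folklore] -/
theorem eq_Lof_of_piT (L x : σ →₀ ℕ) (h : piT (segM I) L = x) : L I.a ∈ KR I x ∧ L = Lof I x (L I.a) := by
  have ha := piT_segM_a I L; have hb := piT_segM_b I L; have hc := piT_segM_c I L; have hd := piT_segM_d I L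
  rw [h] at ha hb hc hd
  refine ⟨(mem_KR I x _).2 ⟨by omega, by omega, by omega⟩, ?_⟩
  ext j
  by_cases hja : j = I.a
  · subst hja; rw [Lof_a]
  by_cases hjb : j = I.b
  · subst hjb; rw [Lof_b]; omega
  by_cases hjc : j = I.c
  · subst hjc; rw [Lof_c]; omega
  by_cases hjd : j = I.d
  · subst hjd; rw [Lof_d]; omega
  rw [Lof_other I x _ j hja hjb hjc hjd, ← h, piT_segM_other I L j hja hjb hjc hjd]

/-- (F2) Every admissible `Lof x k` lies in the fibre over a balanced `x`. [folklore] -/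
theorem piT_Lof (x : σ →₀ ℕ) (hx : Balanced I x) (k : ℕ) (hk : k ∈ KR I x) : piT (segM I) (Lof I x k) = x := by
  rw [mem_KR] at hk
  unfold Balanced at hx
  ext j
  by_cases hja : j = I.a
  · subst hja; rw [piT_segM_a, Lof_a, Lof_c]; omega
  by_cases hjb : j = I.b
  · subst hjb; rw [piT_segM_b, Lof_b, Lof_d]; omega
  by_cases hjc : j = I.c
  · subst hjc; rw [piT_segM_c, Lof_a, Lof_d]; omega
  by_cases hjd : j = I.d
  · subst hjd; rw [piT_segM_d, Lof_b, Lof_c]; omega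
  rw [piT_segM_other I _ j hja hjb hjc hjd, Lof_other I x k j hja hjb hjc hjd]

/-- (F4) The degree is constant along the fibre: `deg (Lof x k) = deg x̂`. [folklore] -/
theorem deg_Lof (x : σ →₀ ℕ) (k : ℕ) (hk : k ∈ KR I x) : deg (Lof I x k) = deg (xhat I x) := by
  rw [mem_KR] at hk
  rw [deg_eq_sum, deg_eq_sum, sum_four_split I, sum_four_split I, Lof_a, Lof_b, Lof_c, Lof_d, xhat_a, xhat_b, xhat_c,
    xhat_d]
  have : ∑ j ∈ rest I, (Lof I x k) j = ∑ j ∈ rest I, (xhat I x) j := by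
    refine Finset.sum_congr rfl fun j hj => ?_
    rw [mem_rest] at hj
    rw [Lof_other I x k j hj.1 hj.2.1 hj.2.2.1 hj.2.2.2, xhat_other I x j hj.2.2.1 hj.2.2.2]
  rw [this]; omega

/-- The degree of the reduced exponent. [folklore] -/
theorem deg_xhat (x : σ →₀ ℕ) : deg (xhat I x) = (∑ j ∈ rest I, x j) + (x I.a + x I.b) := by
  rw [deg_eq_sum, sum_four_split I, xhat_a, xhat_b, xhat_c, xhat_d, add_zero, add_zero]
  congr 1
  refine Finset.sum_congr rfl fun j hj => ?_
  rw [mem_rest] at hj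
  rw [xhat_other I x j hj.2.2.1 hj.2.2.2]

/-- The full degree of a balanced exponent in terms of the reduced one. [folklore] -/
theorem deg_eq_deg_xhat_add (x : σ →₀ ℕ) : deg x = deg (xhat I x) + (x I.c + x I.d) := by
  rw [deg_xhat, deg_eq_sum, sum_four_split I]; ring

omit [DecidableEq σ] in
/-- Multinomial coefficients over the whole (finite) index type. [folklore] -/
theorem multinomial_univ (f : σ →₀ ℕ) : f.multinomial = Nat.multinomial Finset.univ f := by
  classical
  rw [Finsupp.multinomial_eq]
  unfold Nat.multinomial
  rw [Finset.sum_subset (Finset.subset_univ _) (fun j _ hj => by simpa using hj),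
    Finset.prod_subset (Finset.subset_univ _) (fun j _ hj => by
      rw [Finsupp.notMem_support_iff.mp hj, Nat.factorial_zero])]

/-- (F5) Multinomial regrouping along the fibre:
`n!/(k! (x_b+k-x_c)! (x_a-k)! (x_c-k)! M!) = n!/(x_a! x_b! M!) · C(x_a, k) · C(x_b, x_c - k)`. [folklore] -/
theorem multinomial_Lof (x : σ →₀ ℕ) (k : ℕ) (hk : k ∈ KR I x) :
    (Lof I x k).multinomial = (xhat I x).multinomial * ((x I.a).choose k * (x I.b).choose (x I.c - k)) := by
  have hk' := (mem_KR I x k).1 hk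
  have hdeg := deg_Lof I x k hk
  rw [deg_eq_sum, deg_eq_sum] at hdeg
  have sL := Nat.multinomial_spec (Finset.univ : Finset σ) (Lof I x k)
  have sX := Nat.multinomial_spec (Finset.univ : Finset σ) (xhat I x)
  rw [← multinomial_univ] at sL sX
  rw [hdeg, ← sX] at sL
  -- the factorial identity
  have P : (∏ j, ((Lof I x k) j).factorial) * ((x I.a).choose k * (x I.b).choose (x I.c - k)) =
      ∏ j, ((xhat I x) j).factorial := by
    rw [prod_four_split I, prod_four_split I, Lof_a, Lof_b, Lof_c, Lof_d, xhat_a, xhat_b, xhat_c, xhat_d]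
    have hr : ∏ j ∈ rest I, ((Lof I x k) j).factorial = ∏ j ∈ rest I, ((xhat I x) j).factorial := by
      refine Finset.prod_congr rfl fun j hj => ?_
      rw [mem_rest] at hj
      rw [Lof_other I x k j hj.1 hj.2.1 hj.2.2.1 hj.2.2.2, xhat_other I x j hj.2.2.1 hj.2.2.2]
    rw [hr, Nat.factorial_zero, mul_one]
    have h1 : (x I.a).choose k * k.factorial * (x I.a - k).factorial = (x I.a).factorial :=
      Nat.choose_mul_factorial_mul_factorial hk'.2.1
    have h2 : (x I.b).choose (x I.c - k) * (x I.c - k).factorial * (x I.b - (x I.c - k)).factorial =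
        (x I.b).factorial := Nat.choose_mul_factorial_mul_factorial (by omega)
    have h3 : x I.b + k - x I.c = x I.b - (x I.c - k) := by omega
    rw [h3, ← h1, ← h2]; ring
  have hpos : 0 < ∏ j, ((Lof I x k) j).factorial := Finset.prod_pos fun j _ => Nat.factorial_pos _
  apply Nat.eq_of_mul_eq_mul_left hpos
  rw [sL, ← P]; ring

/-! ## Part T4: binomial characters, the tool interface `BinExpPencilCount` (verbatim copy of the interface of record
`Cruxes/TwoProducts/Lines/relation_ladder_R6_tool.lean :: R6Tool.BinExpPencilCount`), and the slice sums -/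

/-- The binomial character `ν ↦ C(ν, d) · a ^ (ν - d)` (verbatim copy of `R6Tool.binChar`). [folklore] -/
def binChar (a : ℂ) (d ν : ℕ) : ℂ := (Nat.choose ν d : ℂ) * a ^ (ν - d)

omit [Fintype σ] [DecidableEq σ] in
/-- A binomial character of degree `0` is the pure character `a ^ ν`. [folklore] -/
theorem binChar_zero_deg (a : ℂ) (ν : ℕ) : binChar a 0 ν = a ^ ν := by
  simp [binChar]

omit [Fintype σ] [DecidableEq σ] in
/-- A binomial character with base `0` is the indicator of `ν = d`. [folklore] -/
theorem binChar_base_zero (d ν : ℕ) : binChar 0 d ν = if ν = d then 1 else 0 := by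
  unfold binChar
  rcases lt_trichotomy ν d with h | rfl | h
  · simp [Nat.choose_eq_zero_of_lt h, h.ne]
  · simp
  · rw [if_neg h.ne', zero_pow (Nat.sub_ne_zero_of_lt h), mul_zero]

omit [Fintype σ] [DecidableEq σ] in
/-- A binomial character of degree `d` vanishes at `ν < d`. [folklore] -/
theorem binChar_eq_zero_of_lt (a : ℂ) (d ν : ℕ) (h : ν < d) : binChar a d ν = 0 := by
  simp [binChar, Nat.choose_eq_zero_of_lt h]

/- PORT DELTA (val-lit-p3 g14, filing seat): the source declares here `def BinExpPencilCount : Prop := …` (verbatim copy of the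
tool interface `R6Tool.BinExpPencilCount`).  A parameter-free `def … : Prop` in a Theorems file is treated by the gate as a
named fact and relocated to `Literature/` (bounce p622844), so the port OMITS the def and uses the tool THEOREM directly:
`Summit.ValiantsHypothesis.ValiantsHypothesis.Theorems.NewtonUnitEquations.TwoProducts.FormalLogLinearisation.BinExpSum.binExpPencilCount`
(val-lit-p3 g14, p620797) has LITERALLY that body with witness `A = 3`; `binExpPencilCount_fintype` below is therefore
UNCONDITIONAL (source: hypothesis `hT : BinExpPencilCount`). -/

/-- A signed binomial-exponential sum with term set `κ` on `ℕ^σ`. [folklore] -/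
def bsum {κ : Type*} [Fintype κ] (C : κ → ℂ) (a : κ → σ → ℂ) (d : κ → σ → ℕ) (ν : σ → ℕ) : ℂ :=
  ∑ k, C k * ∏ i, binChar (a k i) (d k i) (ν i)

/-- The binomial width `N = Σ_k ∏_i (d_{k i} + 1)`. [folklore] -/
def bwidth {κ : Type*} [Fintype κ] (d : κ → σ → ℕ) : ℕ := ∑ k, ∏ i, (d k i + 1)

omit [DecidableEq σ] in
/-- Monotonicity of the tool's bound in the width. [folklore] -/
theorem toolBound_mono (s A : ℕ) {N N' : ℕ} (h : N ≤ N') :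
    (s + 2) ^ A * (N + 2) ^ (A * (Nat.log 2 (N + 2) + 1)) ≤ (s + 2) ^ A * (N' + 2) ^ (A * (Nat.log 2 (N' + 2) + 1)) := by
  refine Nat.mul_le_mul_left _ ?_
  calc (N + 2) ^ (A * (Nat.log 2 (N + 2) + 1)) ≤ (N' + 2) ^ (A * (Nat.log 2 (N + 2) + 1)) :=
        Nat.pow_le_pow_left (by omega) _
    _ ≤ (N' + 2) ^ (A * (Nat.log 2 (N' + 2) + 1)) :=
        Nat.pow_le_pow_right (by omega) (Nat.mul_le_mul_left _ (by
          have := Nat.log_mono_right (b := 2) (show N + 2 ≤ N' + 2 by omega); omega))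

/-- **The tool for an arbitrary finite term set** (transport of `BinExpSum.binExpPencilCount` along `Fintype.equivFin`;
UNCONDITIONAL — port delta, see above). [folklore] -/
theorem binExpPencilCount_fintype :
    ∃ A : ℕ, ∀ (s : ℕ) (κ : Type) [Fintype κ] (C : κ → ℂ) (a : κ → Fin s → ℂ) (d : κ → Fin s → ℕ)
      (u v : Fin s → ℝ) (S : Finset (Fin s → ℕ)),
      (∀ μ ∈ S, bsum C a d μ ≠ 0 ∧ ∃ t : ℝ, ∀ ν : Fin s → ℕ, ν ≠ μ → bsum C a d ν ≠ 0 →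
        ∑ i, (u i + t * v i) * (μ i : ℝ) < ∑ i, (u i + t * v i) * (ν i : ℝ)) →
      S.card ≤ (s + 2) ^ A * (bwidth d + 2) ^ (A * (Nat.log 2 (bwidth d + 2) + 1)) := by
  obtain ⟨A, hA⟩ :=
    Summit.ValiantsHypothesis.ValiantsHypothesis.Theorems.NewtonUnitEquations.TwoProducts.FormalLogLinearisation.BinExpSum.binExpPencilCount
  refine ⟨A, fun s κ _ C a d u v S hS => ?_⟩
  set e := Fintype.equivFin κ with he
  have hsum : ∀ ν : Fin s → ℕ,
      (∑ k : Fin (Fintype.card κ), C (e.symm k) * ∏ i, ((ν i).choose (d (e.symm k) i) : ℂ) *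
        a (e.symm k) i ^ (ν i - d (e.symm k) i)) = bsum C a d ν := fun ν => by
    unfold bsum binChar
    exact Equiv.sum_comp e.symm (fun k => C k * ∏ i, (((ν i).choose (d k i) : ℂ) * a k i ^ (ν i - d k i)))
  have hw : (∑ k : Fin (Fintype.card κ), ∏ i, (d (e.symm k) i + 1)) = bwidth d := by
    unfold bwidth
    exact Equiv.sum_comp e.symm (fun k => ∏ i, (d k i + 1))
  have := hA s (Fintype.card κ) (fun k => C (e.symm k)) (fun k => a (e.symm k)) (fun k => d (e.symm k)) u v S
    (fun μ hμ => by
      obtain ⟨h1, t, ht⟩ := hS μ hμ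
      refine ⟨by rw [hsum]; exact h1, t, fun ν hne hν => ht ν hne (by rw [← hsum]; exact hν)⟩)
  rw [hw] at this
  exact this

end Summit.ValiantsHypothesis.ValiantsHypothesis.Theorems.NewtonUnitEquations.TwoProducts.PermutationType

end
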